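import Summits.ResolutionOfSingularities.ResolutionOfSingularities.Theorems.FrobeniusClosingPatchingRelPerfectDepthLegalTraceFactor
import Summits.ResolutionOfSingularities.ResolutionOfSingularities.Theorems.FrobeniusClosingPatchingRelPerfectDepthLegalCurvePoint
import Summits.ResolutionOfSingularities.ResolutionOfSingularities.Theorems.FrobeniusClosingPatchingRelPerfectDepthLegalCurveLift
import Summits.ResolutionOfSingularities.ResolutionOfSingularities.Theorems.FrobeniusClosingPatchingRelPerfectDepthLegalHostLift
import Summits.ResolutionOfSingularities.ResolutionOfSingularities.Theorems.FrobeniusClosingPatchingRelPerfectDepthLegalRspChoice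
import Literature.AlgebraicGeometry.Resolution.MarkedIdealsEtale
import Literature.AlgebraicGeometry.Resolution.BlowupDisjointCentreWeights
import HarnessLib

/-!
# Crux `PatchingRelPerfect` (stmt-ResolutionOfSingularities-16161), chain W5.2 — T6-E1b residual `LegalScopedDivisorReduction₃`,
# PHASE 2 closer (2b), spec §D4 ORACLE PLAN: THE POINTWISE ORACLE LEMMA (case `|A_Γ| = 1`)

[OURS · L1 W5.2 · res-L1-w52-lead-1 g6, hand #3b; spec `L/res-L1-w52-lead-1/PHASE2-STEPB-SPEC.md` §D4 ORACLE PLAN, CASE |A_Γ| = 1]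
Replaces the role of NO printed item; NOT a statement of the manuscript under review; fact-free.

At a point `x` of the host SURFACE `X = V(D)` (`ι : X ↪ E`, `D_{ιx} = (z)`, `z ∉ 𝔪²`, at most two labels) carrying a labelled
simple-normal-crossings family `𝓔` (the components of the STEP A divisor `B_X` through `x`: coordinates `v`, generic points `gen G`),
let `ℬ` be the boundary (snc at `ι x`), every member of which through `ι x` has NON-ZERO trace supported near `x` in `⋃ 𝓔`.  Let
`Γ = cl{ι gen G₀}` be the chosen branch and `F₁ ∋ ι gen G₀` its member.  Under the two PRIORITY hypotheses of the oracle as seen from `x` —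
(b) no branch through `x` lies on two members, (a) if some member is tangent to `X` along some branch `G` through `x` (`F|_X ≤ 𝓘_G²`)
then `F₁` is tangent to `X` along `Γ` — the boundary `ℬ` has simple normal crossings with `𝓘(Γ)` at `ι x`.

Proof: every trace germ is a monomial `c · ∏ v_i^{k_i}` in the branch coordinates (…DepthLegalTraceFactor), `F ∋ ι gen G ↔ k_F(lab G) ≠ 0`;
with `≤ 2` branches and (b) at most ONE other member `F` passes through `ι x`, along the other branch `G′` only; if `k_F(lab G′) = 1` the
coordinates `(z, u₀, u′)` and L4 give a generator of `𝓘(Γ)_{ιx} = (z, u₀)` outside `(f₁) + (f_F) + 𝔪²` and step (ii) concludes; if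
`k_F(lab G′) ≥ 2`, (a) forces `v₀² ∣ f̄₁` too, so `f₁, f_F ∈ (z) + 𝔪²`, contradicting their independence modulo `𝔪²`.

AI-written; AI review is weaker than expert review.

## References
* H. Matsumura, *Commutative Ring Theory* (1986), Thm. 14.2, Thm. 14.3. [Matsumura1987]
* J. Kollár, *Lectures on Resolution of Singularities* (2007), 3.104 Step 2.1. [Kollar2007]
-/

-- `Summit.<Summit>.<Sub>.Theorems` with `Sub = Summit` (single-conjunct summit, D-0017)
set_option linter.dupNamespace false

noncomputable section

open CategoryTheory CategoryTheory.Limits AlgebraicGeometry TopologicalSpace IsLocalRing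
open Literature.AlgebraicGeometry.Resolution Scheme.IdealSheafData

namespace Summit.ResolutionOfSingularities.ResolutionOfSingularities.Theorems

universe u

namespace DepthLegal

open DepthSNC

/-! ## §1 Two more ring lemmas on monomials in a part of a regular system of parameters -/

section Ring

variable {R : Type*} [CommRing R] [IsLocalRing R] {n : ℕ} {z : Fin n → R}

/-- `z_i^m ∣ c · ∏_j z_j^{k_j}` iff `m ≤ k_i` (the `z_j` are pairwise non-associated primes). [cite: Matsumura1987, Thm. 14.3] -/
theorem _root_.Literature.AlgebraicGeometry.Resolution.IsRsopPart.pow_dvd_unit_mul_prod_pow_iff (hz : IsRsopPart z) {c : R}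
    (hc : IsUnit c) (k : Fin n → ℕ) (i : Fin n) (m : ℕ) : z i ^ m ∣ c * ∏ j, z j ^ k j ↔ m ≤ k i := by
  classical
  haveI := hz.isRegularLocalRing
  haveI := isDomain_of_isRegularLocalRing R
  have hsplit : c * ∏ j, z j ^ k j = (c * ∏ j ∈ ({i} : Finset (Fin n))ᶜ, z j ^ k j) * z i ^ k i := by
    rw [← Finset.prod_mul_prod_compl ({i} : Finset (Fin n)) (f := fun j => z j ^ k j), Finset.prod_singleton]; ring
  constructor
  · intro h
    rw [hsplit] at h
    have hndvd : ¬ z i ∣ c * ∏ j ∈ ({i} : Finset (Fin n))ᶜ, z j ^ k j := by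
      intro hd
      have h1 : z i ∣ ∏ j ∈ ({i} : Finset (Fin n))ᶜ, z j ^ k j := (hc.dvd_mul_left).mp hd
      obtain ⟨j, hj, hdj⟩ := (hz.prime i).exists_mem_finset_dvd h1
      rw [Finset.mem_compl, Finset.mem_singleton] at hj
      exact hz.not_dvd (Ne.symm hj) ((hz.prime i).dvd_of_dvd_pow hdj)
    have h2 : z i ^ m ∣ z i ^ k i := (hz.prime i).pow_dvd_of_dvd_mul_left m hndvd h
    exact (pow_dvd_pow_iff (hz.ne_zero i) (hz.prime i).not_unit).mp h2
  · intro h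
    have h2 : z i ^ k i ∣ ∏ j, z j ^ k j := Finset.dvd_prod_of_mem (fun j => z j ^ k j) (Finset.mem_univ i)
    exact ((pow_dvd_pow (z i) h).trans h2).mul_left c

/-- A monomial with an exponent `≥ 2` lies in `𝔪²`. [folklore] -/
theorem _root_.Literature.AlgebraicGeometry.Resolution.IsRsopPart.unit_mul_prod_pow_mem_sq (hz : IsRsopPart z) (c : R)
    (k : Fin n → ℕ) {i : Fin n} (hi : 2 ≤ k i) : c * ∏ j, z j ^ k j ∈ maximalIdeal R ^ 2 := by
  classical
  have h0 : z i ^ k i ∣ ∏ j, z j ^ k j := Finset.dvd_prod_of_mem (fun j => z j ^ k j) (Finset.mem_univ i)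
  obtain ⟨q, hq⟩ := (pow_dvd_pow (z i) hi).trans h0
  rw [hq, ← mul_assoc, mul_comm c, mul_assoc]
  exact Ideal.mul_mem_right _ _ (Ideal.pow_mem_pow (hz.mem_maximalIdeal i) 2)

/-- Three pairwise distinct elements do not fit in `Fin d` for `d ≤ 2`. [folklore] -/
theorem fin_three_distinct_absurd {d : ℕ} (hd : d ≤ 2) {a b c : Fin d} (hab : a ≠ b) (hac : a ≠ c) (hbc : b ≠ c) : False := by
  classical
  have h3 : ({a, b, c} : Finset (Fin d)).card = 3 := by
    rw [Finset.card_insert_of_notMem, Finset.card_insert_of_notMem, Finset.card_singleton]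
    · simpa using hbc
    · simp only [Finset.mem_insert, Finset.mem_singleton, not_or]; exact ⟨hab, hac⟩
  have := Finset.card_le_univ ({a, b, c} : Finset (Fin d))
  rw [h3, Fintype.card_fin] at this
  omega

end Ring

/-! ## §2 The pointwise oracle lemma -/

variable {E : Scheme.{u}} {D : E.IdealSheafData}

/-- [OURS · L1 W5.2] **THE POINTWISE ORACLE LEMMA** (module docstring). [cite: Matsumura1987, Thm. 14.2] [cite: Kollar2007, 3.104 Step 2.1] -/
theorem sncWithAt_curve_of_unique_member [IsIntegral D.subscheme] (hX : Scheme.IsRegular D.subscheme) (x : D.subscheme)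
    [IsRegularLocalRing (E.presheaf.stalk (D.subschemeι x))]
    {z : E.presheaf.stalk (D.subschemeι x)} (hDx : stalkIdeal D (D.subschemeι x) = Ideal.span {z})
    (hz2 : z ∉ maximalIdeal (E.presheaf.stalk (D.subschemeι x)) ^ 2)
    {ℬ : List E.IdealSheafData} (hℬ : SNCWithAt ℬ ⊤ (D.subschemeι x))
    (htr0 : ∀ F ∈ ℬ, D.subschemeι x ∈ F.support → stalkIdeal (F.comap D.subschemeι) x ≠ ⊥)
    -- labelled coordinates on the host at `x`: at most two branches
    {d : ℕ} (hd2 : d ≤ 2) {v : Fin d → D.subscheme.presheaf.stalk x} (hv : IsRsopPart v)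
    (𝓔 : List D.subscheme.IdealSheafData) (lab : {G : D.subscheme.IdealSheafData // G ∈ 𝓔 ∧ x ∈ G.support} → Fin d)
    (hlabinj : Function.Injective lab) (hlab : ∀ G, stalkIdeal G.1 x = Ideal.span {v (lab G)})
    (gen : {G : D.subscheme.IdealSheafData // G ∈ 𝓔 ∧ x ∈ G.support} → D.subscheme) (hgen : ∀ G, gen G ⤳ x)
    (hgen1 : ∀ G, Order.coheight (gen G) = 1) (hgenP : ∀ G, primeOfSpecializes (hgen G) = Ideal.span {v (lab G)})
    (hsupp : ∀ F ∈ ℬ, ∀ η : D.subscheme, η ⤳ x → η ∈ (F.comap D.subschemeι).support → ∃ G ∈ 𝓔, η ∈ G.support)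
    -- the chosen branch and its member
    (G₀ : {G : D.subscheme.IdealSheafData // G ∈ 𝓔 ∧ x ∈ G.support}) {F₁ : E.IdealSheafData} (h₁ : F₁ ∈ ℬ)
    (hζ₁ : D.subschemeι (gen G₀) ∈ F₁.support)
    -- priority (b) seen from `x`: no branch through `x` lies on two members
    (hb : ∀ G, ∀ F ∈ ℬ, ∀ F' ∈ ℬ, D.subschemeι (gen G) ∈ F.support → D.subschemeι (gen G) ∈ F'.support → F = F')
    -- priority (a) seen from `x`: tangency of some member along some branch forces tangency of `F₁` along `Γ`
    (ha : (∃ G, ∃ F ∈ ℬ, F.comap D.subschemeι ≤ primeDivisorIdeal (gen G) ^ 2) →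
      F₁.comap D.subschemeι ≤ primeDivisorIdeal (gen G₀) ^ 2) :
    SNCWithAt ℬ (vanishingIdeal ⟨closure {D.subschemeι (gen G₀)}, isClosed_closure⟩) (D.subschemeι x) := by
  classical
  -- notation and basic facts
  have hsurj : Function.Surjective (D.subschemeι.stalkMap x).hom := D.subschemeι.stalkMap_surjective x
  have hker : RingHom.ker (D.subschemeι.stalkMap x).hom = Ideal.span {z} := by rw [ker_stalkMap_subschemeι, hDx]
  haveI := hv.isRegularLocalRing
  haveI := isDomain_of_isRegularLocalRing (D.subscheme.presheaf.stalk x)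
  obtain ⟨hregE, dE, V, hdE, hV, ⟨labE, hlabEinj, hlabED⟩, -⟩ := id hℬ
  have hVrsop : IsRsopPart V := by
    have h := isRsopPart_comp_of_rsop hdE V hV id Function.injective_id
    simpa using h
  -- pull-back of `𝔪_X²` is `(z) + 𝔪_E²`
  have hpre : ∀ g : E.presheaf.stalk (D.subschemeι x),
      (D.subschemeι.stalkMap x).hom g ∈ maximalIdeal (D.subscheme.presheaf.stalk x) ^ 2 →
        g ∈ Ideal.span {z} ⊔ maximalIdeal (E.presheaf.stalk (D.subschemeι x)) ^ 2 := by
    intro g hg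
    have h1 : g ∈ (maximalIdeal (D.subscheme.presheaf.stalk x) ^ 2).comap (D.subschemeι.stalkMap x).hom :=
      Ideal.mem_comap.mpr hg
    rw [Ideal.comap_maximalIdeal_pow_of_surjective _ hsurj, hker, sup_comm] at h1
    exact h1
  have hmapsq : ∀ g : E.presheaf.stalk (D.subschemeι x), g ∈ maximalIdeal (E.presheaf.stalk (D.subschemeι x)) ^ 2 →
      (D.subschemeι.stalkMap x).hom g ∈ maximalIdeal (D.subscheme.presheaf.stalk x) ^ 2 := by
    intro g hg
    have h1 : g ∈ (maximalIdeal (D.subscheme.presheaf.stalk x) ^ 2).comap (D.subschemeι.stalkMap x).hom := by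
      rw [Ideal.comap_maximalIdeal_pow_of_surjective _ hsurj]
      exact Ideal.mem_sup_left hg
    exact Ideal.mem_comap.mp h1
  have hz0 : (D.subschemeι.stalkMap x).hom z = 0 := by
    have hg' : z ∈ RingHom.ker (D.subschemeι.stalkMap x).hom := by rw [hker]; exact Ideal.mem_span_singleton_self _
    exact hg'
  -- the curve ideal at `ι x` is `(z, u₀)` with `u₀` a lift of `v (lab G₀)`
  have hζx : D.subschemeι (gen G₀) ⤳ D.subschemeι x := (hgen G₀).map D.subschemeι.continuous
  have hC_X : stalkIdeal (vanishingIdeal ⟨closure {gen G₀}, isClosed_closure⟩ : D.subscheme.IdealSheafData) x =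
      Ideal.span {v (lab G₀)} := by rw [stalkIdeal_vanishingIdeal_closure_singleton (hgen G₀), hgenP]
  obtain ⟨w, hw, hw0, hw1, hCw⟩ := exists_isRsopPart_vanishingIdeal_closure_map x hDx hz2 (hgen G₀) hC_X (hv.not_mem_sq _)
  have hxC : D.subschemeι x ∈ (vanishingIdeal ⟨closure {D.subschemeι (gen G₀)}, isClosed_closure⟩ : E.IdealSheafData).support :=
    mem_support_vanishingIdeal_closure_singleton_iff.mpr hζx
  have hCprime : stalkIdeal (vanishingIdeal ⟨closure {D.subschemeι (gen G₀)}, isClosed_closure⟩ : E.IdealSheafData)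
      (D.subschemeι x) = primeOfSpecializes hζx := stalkIdeal_vanishingIdeal_closure_singleton hζx
  -- `F₁` passes through `ι x` and `F₁,ιx ≤ 𝓘(Γ)_ιx`
  have hxF₁ : D.subschemeι x ∈ F₁.support := hζx.mem_closed F₁.support.isClosed hζ₁
  have hF₁C : stalkIdeal F₁ (D.subschemeι x) ≤
      stalkIdeal (vanishingIdeal ⟨closure {D.subschemeι (gen G₀)}, isClosed_closure⟩ : E.IdealSheafData) (D.subschemeι x) := by
    rw [hCprime]; exact (mem_support_iff_stalkIdeal_le_primeOfSpecializes hζx F₁).mp hζ₁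
  -- a member through `ι x`: generator `f = V (labE F)`, trace germ `ι^♯ f = c · ∏ v^k`, exponents read branches
  have hmem : ∀ F (hF : F ∈ ℬ) (hxF : D.subschemeι x ∈ F.support),
      ∃ (c : D.subscheme.presheaf.stalk x) (k : Fin d → ℕ),
        stalkIdeal (F.comap D.subschemeι) x = Ideal.span {(D.subschemeι.stalkMap x).hom (V (labE ⟨F, hF, hxF⟩))} ∧ IsUnit c ∧
        (D.subschemeι.stalkMap x).hom (V (labE ⟨F, hF, hxF⟩)) = c * ∏ i, v i ^ k i ∧ (∀ i, k i ≠ 0 → ∃ G, lab G = i) ∧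
        (∀ G, D.subschemeι (gen G) ∈ F.support ↔ k (lab G) ≠ 0) ∧ (∃ G, D.subschemeι (gen G) ∈ F.support) := by
    intro F hF hxF
    have hf : stalkIdeal F (D.subschemeι x) = Ideal.span {V (labE ⟨F, hF, hxF⟩)} := hlabED ⟨F, hF, hxF⟩
    have htr : stalkIdeal (F.comap D.subschemeι) x = Ideal.span {(D.subschemeι.stalkMap x).hom (V (labE ⟨F, hF, hxF⟩))} := by
      rw [stalkIdeal_comap_eq_map, hf, Ideal.map_span, Set.image_singleton]
    have hf0 : (D.subschemeι.stalkMap x).hom (V (labE ⟨F, hF, hxF⟩)) ≠ 0 := by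
      intro h0; apply htr0 F hF hxF; rw [htr, h0, Ideal.span_singleton_eq_bot]
    obtain ⟨c, k, hc, hfk, hklab⟩ := exists_germ_eq_unit_mul_prod_pow hv 𝓔 lab hlab (F.comap D.subschemeι) htr hf0
      (hsupp F hF)
    have hiff : ∀ G, D.subschemeι (gen G) ∈ F.support ↔ k (lab G) ≠ 0 := by
      intro G
      refine (mem_support_comap_iff D.subschemeι F (gen G)).symm.trans ?_
      refine (mem_support_iff_dvd_of_primeOfSpecializes_eq (hgen G) (hgenP G) (F.comap D.subschemeι) htr).trans ?_
      rw [hfk]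
      exact hv.dvd_unit_mul_prod_pow_iff hc k (lab G)
    refine ⟨c, k, htr, hc, hfk, hklab, hiff, ?_⟩
    -- some exponent is positive (the trace is not a unit at `x`), and positive exponents sit on labels
    by_contra hnone
    have hall : ∀ i, k i = 0 := by
      intro i
      by_contra hi
      obtain ⟨G, hG⟩ := hklab i hi
      exact hnone ⟨G, (hiff G).mpr (hG ▸ hi)⟩
    have hunit : IsUnit ((D.subschemeι.stalkMap x).hom (V (labE ⟨F, hF, hxF⟩))) := by
      rw [hfk]; simp [hall, hc]
    have hxtr : x ∈ (F.comap D.subschemeι).support := (mem_support_comap_iff D.subschemeι F x).mpr hxF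
    rw [mem_support_iff_stalkIdeal_le, htr, Ideal.span_singleton_le_iff_mem] at hxtr
    exact ((mem_maximalIdeal _).mp hxtr) hunit
  -- the data of `F₁`
  obtain ⟨c₁, k₁, htr₁, hc₁, hf₁k, hk₁lab, hk₁iff, -⟩ := hmem F₁ h₁ hxF₁
  set f₁ := V (labE ⟨F₁, h₁, hxF₁⟩) with hf₁def
  have hf₁ : stalkIdeal F₁ (D.subschemeι x) = Ideal.span {f₁} := hlabED ⟨F₁, h₁, hxF₁⟩
  have hf₁m : f₁ ∈ maximalIdeal (E.presheaf.stalk (D.subschemeι x)) := hVrsop.mem_maximalIdeal _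
  -- any other member through `ι x` misses the generic point of `Γ` and passes through another branch `G' ≠ G₀`
  have hother : ∀ F (hF : F ∈ ℬ) (hxF : D.subschemeι x ∈ F.support), F ≠ F₁ →
      ∃ G', G' ≠ G₀ ∧ D.subschemeι (gen G') ∈ F.support ∧ D.subschemeι (gen G₀) ∉ F.support := by
    intro F hF hxF hne
    obtain ⟨-, -, -, -, -, -, -, ⟨G', hG'⟩⟩ := hmem F hF hxF
    have hG₀ : D.subschemeι (gen G₀) ∉ F.support := fun h => hne (hb G₀ F hF F₁ h₁ h hζ₁)
    refine ⟨G', ?_, hG', hG₀⟩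
    rintro rfl; exact hG₀ hG'
  -- at most one other member passes through `ι x`
  have hcount : ∀ F (hF : F ∈ ℬ) (hxF : D.subschemeι x ∈ F.support) F' (hF' : F' ∈ ℬ) (hxF' : D.subschemeι x ∈ F'.support),
      F ≠ F₁ → F' ≠ F₁ → F = F' := by
    intro F hF hxF F' hF' hxF' hne hne'
    obtain ⟨G, hGne, hGF, -⟩ := hother F hF hxF hne
    obtain ⟨G', hG'ne, hG'F', -⟩ := hother F' hF' hxF' hne'
    by_cases hGG' : G = G'
    · subst hGG'; exact hb G F hF F' hF' hGF hG'F'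
    · exact (fin_three_distinct_absurd hd2 (fun h => hGne.symm (hlabinj h)) (fun h => hG'ne.symm (hlabinj h))
        (fun h => hGG' (hlabinj h))).elim
  -- the members through `ι x` generate at most `(f₁) + (f)`
  by_cases hM : ∃ F ∈ ℬ, D.subschemeι x ∈ F.support ∧ F ≠ F₁
  · -- TWO members through `ι x`
    obtain ⟨F, hF, hxF, hne⟩ := hM
    obtain ⟨c, k, htr, hc, hfk, hklab, hkiff, -⟩ := hmem F hF hxF
    set f := V (labE ⟨F, hF, hxF⟩) with hfdef
    have hf : stalkIdeal F (D.subschemeι x) = Ideal.span {f} := hlabED ⟨F, hF, hxF⟩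
    obtain ⟨G', hG'ne, hG'F, hG₀F⟩ := hother F hF hxF hne
    have hk0 : k (lab G₀) = 0 := by by_contra h; exact hG₀F ((hkiff G₀).mpr h)
    have hkG' : k (lab G') ≠ 0 := (hkiff G').mp hG'F
    have hlabne : lab G₀ ≠ lab G' := fun h => hG'ne (hlabinj h).symm
    have hsupmem : (⨆ (D' : E.IdealSheafData) (_ : D' ∈ ℬ ∧ D.subschemeι x ∈ D'.support), stalkIdeal D' (D.subschemeι x)) ≤
        Ideal.span {f₁} ⊔ Ideal.span {f} := by
      refine iSup₂_le fun D' hD' => ?_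
      by_cases hD'1 : D' = F₁
      · subst hD'1; rw [hf₁]; exact le_sup_left
      · have hD'F : D' = F := hcount D' hD'.1 hD'.2 F hF hxF hD'1 hne
        subst hD'F; rw [hf]; exact le_sup_right
    by_cases hb2 : 2 ≤ k (lab G')
    · -- `F` tangent to the host along `G'`: priority (a) makes `F₁` tangent along `Γ`, contradiction with snc of `ℬ`
      exfalso
      have hFle : F.comap D.subschemeι ≤ primeDivisorIdeal (gen G') ^ 2 := by
        refine le_primeDivisorIdeal_pow_of_isRegular hX (hgen1 G') ?_
        rw [← stalkIdeal_map_stalkSpecializes (F.comap D.subschemeι) (hgen G'), htr, Ideal.map_span, Set.image_singleton,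
          Ideal.span_singleton_le_iff_mem, hfk]
        obtain ⟨q, hq⟩ := (hv.pow_dvd_unit_mul_prod_pow_iff hc k (lab G') 2).mpr hb2
        have hvm : (D.subscheme.presheaf.stalkSpecializes (hgen G')).hom (v (lab G')) ∈
            maximalIdeal (D.subscheme.presheaf.stalk (gen G')) := by
          have h1 : v (lab G') ∈ primeOfSpecializes (hgen G') := by rw [hgenP]; exact Ideal.mem_span_singleton_self _
          exact Ideal.mem_comap.mp h1
        rw [hq, map_mul, map_pow]
        exact Ideal.mul_mem_right _ _ (Ideal.pow_mem_pow hvm 2)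
      have h₁le : F₁.comap D.subschemeι ≤ primeDivisorIdeal (gen G₀) ^ 2 := ha ⟨G', F, hF, hFle⟩
      -- hence `v₀² ∣ ι^♯ f₁`, so `ι^♯ f₁ ∈ 𝔪_X²`; and `ι^♯ f ∈ 𝔪_X²`
      have hπf₁ : (D.subschemeι.stalkMap x).hom f₁ ∈ maximalIdeal (D.subscheme.presheaf.stalk x) ^ 2 := by
        have hle := stalkIdeal_mono h₁le x
        rw [stalkIdeal_pow, primeDivisorIdeal, stalkIdeal_vanishingIdeal_closure_singleton (hgen G₀), hgenP,
          Ideal.span_singleton_pow, htr₁, Ideal.span_singleton_le_span_singleton, hf₁k] at hle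
        rw [hf₁k]
        exact hv.unit_mul_prod_pow_mem_sq c₁ k₁ ((hv.pow_dvd_unit_mul_prod_pow_iff hc₁ k₁ (lab G₀) 2).mp hle)
      have hπf : (D.subschemeι.stalkMap x).hom f ∈ maximalIdeal (D.subscheme.presheaf.stalk x) ^ 2 := by
        rw [hfk]; exact hv.unit_mul_prod_pow_mem_sq c k hb2
      -- pull back: `f₁ = a₁ z + m₁`, `f = a z + m`
      obtain ⟨a₁, m₁, hm₁, hf₁eq⟩ := mem_span_singleton_sup_sq_iff.mp (hpre f₁ hπf₁)
      obtain ⟨a, m, hm, hfeq⟩ := mem_span_singleton_sup_sq_iff.mp (hpre f hπf)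
      -- the relation `a f₁ - a₁ f ∈ 𝔪²` among two distinct members of the regular system `V`
      have hidx : labE ⟨F₁, h₁, hxF₁⟩ ≠ labE ⟨F, hF, hxF⟩ := by
        intro h; exact hne (congrArg Subtype.val (hlabEinj h)).symm
      let coef : Fin dE → E.presheaf.stalk (D.subschemeι x) :=
        Pi.single (labE ⟨F₁, h₁, hxF₁⟩) a - Pi.single (labE ⟨F, hF, hxF⟩) a₁
      have hsum : ∑ j, coef j * V j = a * f₁ - a₁ * f := by
        simp only [coef, Pi.sub_apply, sub_mul, Finset.sum_sub_distrib, Pi.single_apply, ite_mul, zero_mul,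
          Finset.sum_ite_eq', Finset.mem_univ, if_true]
        rw [← hf₁def, ← hfdef]
      have hrel : ∑ j, coef j * V j ∈ maximalIdeal (E.presheaf.stalk (D.subschemeι x)) ^ 2 := by
        rw [hsum, hf₁eq, hfeq]
        have : a * (a₁ * z + m₁) - a₁ * (a * z + m) = a * m₁ - a₁ * m := by ring
        rw [this]
        exact Ideal.sub_mem _ (Ideal.mul_mem_left _ _ hm₁) (Ideal.mul_mem_left _ _ hm)
      have ha_m : a ∈ maximalIdeal (E.presheaf.stalk (D.subschemeι x)) := by
        have h := coeff_mem_maximalIdeal_of_sum_mem_sq hVrsop coef hrel (labE ⟨F₁, h₁, hxF₁⟩)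
        simpa [coef, Pi.single_apply, hidx] using h
      -- then `f = a z + m ∈ 𝔪²`, contradicting `f ∉ 𝔪²`
      have hzm : z ∈ maximalIdeal (E.presheaf.stalk (D.subschemeι x)) :=
        (Ideal.span_singleton_le_iff_mem _).mp (hDx ▸ (mem_support_iff_stalkIdeal_le D _).mp (subschemeι_apply_mem_support D x))
      refine hVrsop.not_mem_sq (labE ⟨F, hF, hxF⟩) ?_
      rw [← hfdef, hfeq]
      exact Ideal.add_mem _ (mul_mem_sq ha_m hzm) hm
    · -- `F` transversal to the host along `G'` (`k (lab G') = 1`): coordinates `t = (z, u₀, u')`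
      have hk1 : k (lab G') = 1 := by omega
      -- the exponent vector of `f` is concentrated at `lab G'`
      have hkexact : ∀ i, k i = if i = lab G' then 1 else 0 := by
        intro i
        by_cases hi : i = lab G'
        · rw [if_pos hi, hi, hk1]
        · rw [if_neg hi]
          by_contra hki
          obtain ⟨G'', hG''⟩ := hklab i hki
          have h1 : G'' ≠ G' := fun h => hi (h ▸ hG''.symm)
          have h2 : G'' ≠ G₀ := fun h => by rw [h] at hG''; exact hki (hG'' ▸ hk0)
          exact fin_three_distinct_absurd hd2 hlabne (fun h => h2 (hlabinj h).symm) (fun h => h1 (hlabinj h).symm)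
      have hfk' : (D.subschemeι.stalkMap x).hom f = c * v (lab G') := by
        rw [hfk]
        congr 1
        rw [Finset.prod_eq_single (lab G')]
        · rw [hkexact, if_pos rfl, pow_one]
        · intro j _ hj; rw [hkexact, if_neg hj, pow_zero]
        · intro h; exact absurd (Finset.mem_univ _) h
      -- lift `v (lab G')`
      obtain ⟨u', hu'⟩ := hsurj (v (lab G'))
      have hub : IsRsopPart (![v (lab G₀), v (lab G')] : Fin 2 → D.subscheme.presheaf.stalk x) := by
        have h := hv.comp (![lab G₀, lab G'] : Fin 2 → Fin d) (by
          intro a b hab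
          fin_cases a <;> fin_cases b
          · rfl
          · exact absurd hab hlabne
          · exact absurd hab.symm hlabne
          · rfl)
        convert h using 1
        funext i; fin_cases i <;> rfl
      obtain ⟨ht, htspan⟩ := isRsopPart_cons_lift x hDx hz2 hub ![w 1, u'] (by
        intro i; fin_cases i
        · exact hw1
        · exact hu')
      set t : Fin 3 → E.presheaf.stalk (D.subschemeι x) := Fin.cons z ![w 1, u'] with htdef
      have ht0 : t 0 = z := rfl
      have ht1 : t 1 = w 1 := rfl
      have ht2 : t 2 = u' := rfl
      -- `span {t 0, t 1} = (z, w 1) = span (range w)`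
      have hw01 : Ideal.span {t 0, t 1} = Ideal.span (Set.range w) := by
        rw [ht0, ht1, range_fin_two w, hw0]
      -- `f₁ ∈ (z, u₀)`
      have hf₁t : f₁ ∈ Ideal.span {t 0, t 1} := by
        rw [hw01, ← hCw]; exact hF₁C (hf₁ ▸ Ideal.mem_span_singleton_self _)
      -- `f ∈ (z, u')` : `ι^♯ f = c · v'`, and `(ι^♯)⁻¹ (v') = (u') + ker = (u') + (z)`
      have hft : f ∈ Ideal.span {t 0, t 2} := by
        have h1 : f ∈ (Ideal.span {v (lab G')}).comap (D.subschemeι.stalkMap x).hom := by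
          rw [Ideal.mem_comap, hfk']; exact Ideal.mul_mem_left _ _ (Ideal.mem_span_singleton_self _)
        have h2 : (Ideal.span {v (lab G')}).comap (D.subschemeι.stalkMap x).hom = Ideal.span {u'} ⊔ Ideal.span {z} := by
          rw [← hu', ← Set.image_singleton, ← Ideal.map_span, Ideal.comap_map_of_surjective _ hsurj, ← RingHom.ker_eq_comap_bot,
            hker]
        rw [ht0, ht2, Ideal.span_insert, sup_comm, ← h2]; exact h1
      -- `f ∉ (z) + 𝔪²` : `ι^♯ f = c · v' ∉ 𝔪_X²`
      have hfz : f ∉ Ideal.span {t 0} ⊔ maximalIdeal (E.presheaf.stalk (D.subschemeι x)) ^ 2 := by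
        rw [ht0]
        intro h
        obtain ⟨a, m, hm, hfeq⟩ := mem_span_singleton_sup_sq_iff.mp h
        have h1 : (D.subschemeι.stalkMap x).hom f ∈ maximalIdeal (D.subscheme.presheaf.stalk x) ^ 2 := by
          rw [hfeq, map_add, map_mul, hz0, mul_zero, zero_add]
          exact hmapsq m hm
        rw [hfk'] at h1
        have h2 := hub.not_mem_sq 1
        have h3 : (![v (lab G₀), v (lab G')] : Fin 2 → _) 1 = v (lab G') := rfl
        rw [h3] at h2
        exact h2 ((Ideal.unit_mul_mem_iff_mem _ hc).mp h1)
      obtain ⟨i, hi⟩ := exists_not_mem_span_pair_sup_sq ht hf₁t hft hfz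
      -- `g := t (castSucc i) ∈ {z, u₀} ⊆ 𝓘(Γ)_ιx`
      have hgC : t (Fin.castSucc i) ∈ stalkIdeal (vanishingIdeal ⟨closure {D.subschemeι (gen G₀)}, isClosed_closure⟩ :
          E.IdealSheafData) (D.subschemeι x) := by
        rw [hCw, ← hw01]
        refine Ideal.subset_span ?_
        fin_cases i
        · exact Or.inl rfl
        · exact Or.inr rfl
      refine sncWithAt_curve_of_generator hℬ hxC hw hCw h₁ hxF₁ hF₁C hgC fun hg => hi ?_
      have hle : (⨆ (D' : E.IdealSheafData) (_ : D' ∈ ℬ ∧ D.subschemeι x ∈ D'.support), stalkIdeal D' (D.subschemeι x)) ⊔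
          maximalIdeal (E.presheaf.stalk (D.subschemeι x)) ^ 2 ≤
          Ideal.span {f₁} ⊔ Ideal.span {f} ⊔ maximalIdeal (E.presheaf.stalk (D.subschemeι x)) ^ 2 :=
        sup_le_sup_right hsupmem _
      exact hle hg
  · -- ONLY `F₁` through `ι x`
    have hM' : ∀ F ∈ ℬ, D.subschemeι x ∈ F.support → F = F₁ := by
      intro F hF hxF; by_contra hne; exact hM ⟨F, hF, hxF, hne⟩
    obtain ⟨i, hi⟩ := exists_not_mem_span_singleton_sup_sq hw hf₁m
    have hgC : w i ∈ stalkIdeal (vanishingIdeal ⟨closure {D.subschemeι (gen G₀)}, isClosed_closure⟩ : E.IdealSheafData)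
        (D.subschemeι x) := by rw [hCw]; exact Ideal.subset_span ⟨i, rfl⟩
    refine sncWithAt_curve_of_generator hℬ hxC hw hCw h₁ hxF₁ hF₁C hgC fun hg => hi ?_
    have hsupmem : (⨆ (D' : E.IdealSheafData) (_ : D' ∈ ℬ ∧ D.subschemeι x ∈ D'.support), stalkIdeal D' (D.subschemeι x)) ≤
        Ideal.span {f₁} := by
      refine iSup₂_le fun D' hD' => ?_
      have h := hM' D' hD'.1 hD'.2
      subst h; rw [hf₁]
    exact (sup_le_sup_right hsupmem _) hg

end DepthLegal

end Summit.ResolutionOfSingularities.ResolutionOfSingularities.Theorems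

end
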